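import Summits.Langlands.Langlands.Theses.TameTypeSwitch

/-!
# RATTACK — `TameTypeSwitch.SectorComplement` (stmt-Langlands-18277): kernel-checked position

Refuter one-shot crux attack (seat `refuter-rattack-stmt-Langlands-18277-0`, 2026-08-17) on the
junction item

  `Summit.Langlands.Langlands.Theses.TameTypeSwitch.SectorComplement : Prop :=
     GappedWeightPA → _root_.Langlands`

(crux rank 9 of route `route-Langlands-TameTypeSwitch`; the route's declared COMPLEMENT OF THE SECTOR,
"not this route's business; filed so that `closes` ends in the summit constant").  The crux directory
`Cruxes/SectorComplement/` is SHARED by ≥ 9 homonymous frame items; everything here concerns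
stmt-Langlands-18277 only (prefix `ttsr_`, namespace `…RattackTTS`).  Nothing in this file asserts the
item, its negation, the target or the summit.  Companion report: `RATTACK_TameTypeSwitch.md`.

Findings (all `theorem`s below are sorry-free):
* §1 position — `ttsr_not_sectorComplement_iff : ¬ C ↔ X ∧ ¬ Langlands`: a refutation of C is EXACTLY
  a proof of the open route target X (= `GappedWeightPA`, single-`r` potential automorphy in the gapped
  ℓ-unramified Fontaine–Laffaille cell over CM fields) TOGETHER WITH a refutation of the audited summit.
  `ttsr_sectorComplement_of_langlands : Langlands → C` (S → C, by design of a junction).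
* §2 restates-the-target measure — `ttsr_sectorComplement_imp_langlands_iff : (C → S) ↔ (X ∨ S)`:
  C restates the summit outright iff X (or S) is provable; under X, `C ↔ S`
  (`ttsr_sectorComplement_iff_of_target`); under the route's two CONTENT cruxes, `C ↔ S`
  (`ttsr_sectorComplement_iff_langlands_of_cruxes`, through the route's own `closes` and a proof of the
  `Assembly` item, `ttsr_assembly_holds`, which is glue by kind).
* §3 load-bearing analysis — C has ONE hypothesis, X; C with X dropped is the summit itself
  (`ttsr_sectorComplementWithoutTarget_iff`), so the protocol's `_false_without_X` lemma would be
  `¬ Langlands` — unavailable.  Conversely `ttsr_sectorComplement_of_not_target : ¬ X → C`: were X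
  junk-FALSE, C would close trivially TRUE (for the wrong reason) — never refuted.
* §4 X versus direction (B) of the summit (paper remark, see `RATTACK_TameTypeSwitch.md` §X-vs-S):
  unlike the sibling frames of EisensteinGelfandKirillov (18275, `egk_target_of_langlands`) and
  SenNullAlignment (16308), `Langlands → X` is NOT derivable in-tree by unfolding: X concludes with a
  REGULAR ALGEBRAIC `Π` (`IsRegularAlgebraic`, Clozel C-normalisation, Satake dictionary
  `arithFrobPolyOfSatake ι q n α`, i.e. shift `m = n`), unramified above `ℓ`, Satake–Frobenius
  compatible at EVERY place above every rational prime `q ≠ ℓ` above which `Π` is unramified; the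
  summit's (B) returns an L-ALGEBRAIC `π` (`IsLAlgebraic`, `m = 1`) with `Corresponds` = cofinite Satake
  matching + `LocalGlobalCompatibleAt` everywhere.  Bridging needs the algebraicity twist
  `π ↦ π ⊗ |det|^{(1-n)/2}` (in-tree one way: `IsRegularAlgebraic.exists_twist_isRegular_isLAlgebraic`),
  the Hodge–Tate-cocharacter clause (BG Rem. 3.2.3 — OMITTED from the summit, Statement AUDIT) to get
  regularity of `π_∞` from regular labelled HT weights, and LLC dictionary facts (unramified `rec_v`
  ↔ unramified `π_v` with Satake class; crystalline ⇒ `π_w` unramified at `w ∣ ℓ`).  So `¬ X → ¬ S` is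
  not formally available here; it does not matter for C (refuting C needs X TRUE, not false).
-/

set_option linter.dupNamespace false

namespace Summit.Langlands.Langlands.Cruxes.SectorComplement.RattackTTS

open Summit.Langlands.Langlands.Theses.TameTypeSwitch

/-! ## §0 readback -/

/-- The item's body, literally. [folklore] -/
theorem ttsr_sectorComplement_iff : SectorComplement ↔ (GappedWeightPA → _root_.Langlands) :=
  Iff.rfl

/-! ## §1 logical position -/

/-- S → C: the frame is implied by the summit (discard the sector hypothesis). [folklore] -/
theorem ttsr_sectorComplement_of_langlands : _root_.Langlands → SectorComplement :=
  fun h _ ↦ h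

/-- Under the route TARGET, `SectorComplement ↔ Langlands`. [folklore] -/
theorem ttsr_sectorComplement_iff_of_target (hX : GappedWeightPA) :
    SectorComplement ↔ _root_.Langlands :=
  ⟨fun hC ↦ hC hX, fun h _ ↦ h⟩

/-- The exact content of a refutation of the frame: prove the (open) sector theorem X AND disprove
the formal summit. [folklore] -/
theorem ttsr_not_sectorComplement_iff :
    ¬ SectorComplement ↔ GappedWeightPA ∧ ¬ _root_.Langlands :=
  Classical.not_imp

/-- A refutation of the frame refutes the audited summit … [folklore] -/
theorem ttsr_not_langlands_of_not_sectorComplement (h : ¬ SectorComplement) : ¬ _root_.Langlands :=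
  (ttsr_not_sectorComplement_iff.1 h).2

/-- … and proves the open route target. [folklore] -/
theorem ttsr_target_of_not_sectorComplement (h : ¬ SectorComplement) : GappedWeightPA :=
  (ttsr_not_sectorComplement_iff.1 h).1

/-- Truth table of the frame. [folklore] -/
theorem ttsr_sectorComplement_iff_not_or :
    SectorComplement ↔ ¬ GappedWeightPA ∨ _root_.Langlands :=
  imp_iff_not_or

/-! ## §2 restates-the-target measure -/

/-- `C → S` holds iff `X ∨ S` is provable: the frame restates the summit outright exactly when the
route target (or the summit) is a theorem. [folklore] -/
theorem ttsr_sectorComplement_imp_langlands_iff :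
    (SectorComplement → _root_.Langlands) ↔ (GappedWeightPA ∨ _root_.Langlands) := by
  constructor
  · intro h
    by_cases hX : GappedWeightPA
    · exact Or.inl hX
    · exact Or.inr (h fun hX' ↦ absurd hX' hX)
  · rintro (hX | hS) hC
    · exact hC hX
    · exact hS

/-! ## §3 load-bearing analysis: the single hypothesis X -/

/-- C with its only hypothesis dropped. -/
def SectorComplementWithoutTarget : Prop := _root_.Langlands

/-- Dropping X leaves the summit itself; the protocol's `_false_without_X` lemma would be
`¬ Langlands` and is not available (it would refute the audited summit statement). [folklore] -/
theorem ttsr_sectorComplementWithoutTarget_iff : SectorComplementWithoutTarget ↔ _root_.Langlands :=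
  Iff.rfl

/-- Were X junk-FALSE, C would close trivially TRUE (ex falso) — a `proved` for the wrong reason,
never a refutation. (X is neither provable nor refutable by `exact?`/`aesop`, Scratch.lean.)
[folklore] -/
theorem ttsr_sectorComplement_of_not_target (hX : ¬ GappedWeightPA) : SectorComplement :=
  fun h ↦ absurd h hX

/-! ## §2bis under the route's own content cruxes, C IS the summit -/

set_option maxHeartbeats 400000 in
/-- The two content cruxes give the target: `TameTypedWitness` supplies `K'`, `hcpt'`, `τ'`, the
weight-0 depth-zero witness `π` and its avatar `r₀`; `TypedWitnessFLLifting` over `F := K'` (CM branch)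
applied to `ρ := r|Γ_{K'}` returns `Π`.  Two applications and one `∃`-repacking; the gap clause of X
is unused (the cruxes prove the gap-free strengthening).  Independently re-derived (same term as the
strategist's `gappedWeightPA_of_cruxes`). [folklore] -/
theorem ttsr_target_of_cruxes (hW : TameTypedWitness) (hL : TypedWitnessFLLifting) :
    GappedWeightPA := by
  intro K _ _ hK Kav _ _ hfd n B hn ℓ _ hℓn hℓB hunr k ι r τ hur hcr _hgap hres hirr hdg H hirrH hen hsc
  obtain ⟨K', iF, iN, iA, hgal, hcm, hdisj, hunr', hcpt', τ', π, r₀, hur', hcr', hres', hirr', hdg',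
      hirrH', hen', hsc', hw0, hcompat, hres₀, h𝔫⟩ :=
    hW K hK Kav hfd n B hn ℓ hℓn hℓB hunr ι r τ hur hcr hres hirr hdg hirrH hen hsc
  obtain ⟨Pi, hreg, hPicompat, hPiunr⟩ :=
    hL K' (Or.inr hcm) n B hcpt' ℓ hℓn hℓB hunr' ι (r.restrictField K') τ' π r₀ hur' hcr'
      hres' hirr' hdg' hirrH' hen' hsc' hw0 hcompat hres₀ h𝔫
  exact ⟨K', iF, iN, iA, hgal, hcm, hdisj, hunr', hcpt', Pi, hreg, hPicompat, hPiunr⟩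

/-- The route's `Assembly` item (stmt-Langlands-18278) holds: glue by kind. [folklore] -/
theorem ttsr_assembly_holds : Assembly :=
  fun hW hL hJ ↦ hJ (ttsr_target_of_cruxes hW hL)

/-- Under the two CONTENT cruxes (both OPEN items) `SectorComplement ↔ Langlands`; `→` is the
route's deciding theorem `closes` with the proved `Assembly` plugged in.  Costume-under-cruxes, which
is what a junction is. [folklore] -/
theorem ttsr_sectorComplement_iff_langlands_of_cruxes (hW : TameTypedWitness)
    (hL : TypedWitnessFLLifting) : SectorComplement ↔ _root_.Langlands :=
  ⟨fun hC ↦ closes hW hL hC ttsr_assembly_holds, fun h _ ↦ h⟩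

/-! ## §5 what C carries beyond the sector: e.g. local Langlands data everywhere -/

/-- The frame carries the summit's shared Statement debt: together with the route target it yields
a local Langlands datum for `GL_n(F_v)` at every finite place of every number field — Harris–Taylor /
Henniart content, outside any potential-automorphy cell over CM fields. [folklore] -/
theorem ttsr_sectorComplement_localLanglandsDebt (hC : SectorComplement) (hX : GappedWeightPA)
    (F : Type) [Field F] [NumberField F]
    (v : IsDedekindDomain.HeightOneSpectrum (NumberField.RingOfIntegers F)) :
    Nonempty (Literature.NumberTheory.Automorphic.LocalLanglandsDatum (v.adicCompletion F)) := by
  obtain ⟨⟨𝓡⟩, -⟩ := hC hX F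
  exact ⟨𝓡.llc v⟩

/-- … and direction (B) over the BASE field `K` itself for every `n ≥ 1` (in particular the descent
`K' → K` of X's potential automorphy and every irregular / non-CM case): the whole reciprocity
correspondence, relative to all reciprocity data. [folklore] -/
theorem ttsr_sectorComplement_globalDebt (hC : SectorComplement) (hX : GappedWeightPA)
    (F : Type) [Field F] [NumberField F] (𝓡 : Summit.Langlands.ReciprocityData F) (n : ℕ)
    (hn : 0 < n) (hcpt : Literature.NumberTheory.Automorphic.isCompact_glFiniteIntegralLevel n F) :
    Summit.Langlands.GlobalLanglandsCorrespondenceGLn n F 𝓡 hcpt :=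
  (hC hX F).2 𝓡 n hn hcpt

end Summit.Langlands.Langlands.Cruxes.SectorComplement.RattackTTS
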